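import Summits.BirchSwinnertonDyer.BirchSwinnertonDyer.Theorems.PrintCf2SplitBadTwoCMShaEigenImage
import Summits.BirchSwinnertonDyer.BirchSwinnertonDyer.Theorems.PrintCf2SplitBadTwoRestrictedSelmerKummerInRestricted
import Summits.BirchSwinnertonDyer.BirchSwinnertonDyer.Theorems.PrintCf2SplitBadTwoRestrictedSelmerLocalTrivialAwayFromP
import Mathlib.LinearAlgebra.Projection
import HarnessLib

/-!
# Crux `PrintCf2.SplitBadTwoRankOneOfFacts` (item stmt-BirchSwinnertonDyer-20368), road α, S3c₂ bottom value, factor (F2):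
# the `r`-eigen subgroup of `Ш(E_K/K)[p^∞]` IS the image of the `𝔮`-summand's true Selmer group — the `⊇` half

Cell `bsd-print-cf2`, width seat `bsd-line-cf2-p1-w8` g2 (brick **B6f**, part 2); `--supports stmt-BirchSwinnertonDyer-20368` (helper, Theses-free).
HONEST FRAMING: nothing here closes a crux or a stub; BSD is not proved by any of this; no summit statement is proved by this seat. No definition,
no named fact, no `sorry`. beyond-print theorem: no.

SETTING: `V/K` elliptic over a number field, `p` prime, `π ∈ End_K(E)`, `r ∈ ℤ_p` with `2r − 1` a UNIT, the two eigen-summands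
`M = E[𝔮^∞] = V.endEigenPrimaryTorsion p π r`, `M̄ = V.endEigenPrimaryTorsion p π (1 − r)` COMPLEMENTARY in `E[p^∞]` (`M ⊓ M̄ = ⊥`,
`M ⊔ M̄ = ⊤`: the crux class by `endEigenPrimaryTorsion_compl_of_frame`), -w7 g2's bridge `f = primaryH1ToH1 ∘ res_⊤⁻¹ ∘ ι_*` and true Selmer group
of the summand `S_M = 𝔖_v(K, M) ⊓ L_M` (`…RestrictedSelmerBottomShaBridge`), and THE `r`-eigen subgroup `C ≤ Ш(E_K/K)[p^∞]` (-w2 g7 / -w8 currency).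

* §1 the `Γ_K`-equivariant PROJECTOR `e : E[p^∞] → M` along `M̄` (Mathlib `Submodule.projection` on `AddSubgroup.toIntSubmodule`) and its
  cohomological shadow: `exists_projector`, `resH1Hom_projector_decomp` (`η = ι_*(e_* η) + ι'_*(e'_* η)` in `H¹(⊤, E[p^∞])`),
  `resOfLe_resH1Hom_id_comm` (projectors commute with restriction to a decomposition group), `resH1Hom_injective_of_retraction`.
* §2 `eq_zero_of_zsmul_eq_zero_of_unit_approx` — `p^k y = 0`, `A y = 0`, `A ≡ u (mod p^k)` with `u ∈ ℤ_pˣ` force `y = 0`.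
* §3 **`exists_mem_trueSelmer_shaBridge_eq`** — every `x ∈ C` IS `f c` for some `c ∈ S_M`, GRANTED two displayed local CM inputs at the primes
  above `p` (the (H1′)-type hypotheses of -w7 g2's lane, B7/T4): (Hv) the `M`-component of a class classical at `v` restricts to `0` on
  `⊤ ⊓ D_v` (the formal group at `v` is `E[v^∞] = M̄`); (Hv̄) the `M`-component of a class classical at `v̄` is classical at `v̄`. Proof: `x` lifts to
  `ξ ∈ Sel_{p^∞}(E/K)` (`range_primaryH1ToH1 = H¹(K,E)[p^∞]`, `Sel = primaryH1ToH1⁻¹ Ш`); `η = res_⊤ ξ = ι_* c₁ + ι'_* c₂`; `Ш(φ)` acts on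
  `f c₁` as `N ≡ r` and on `f' c₂` as `N' ≡ 1 − r` (part 1, `galH1Map_shaBridge_eq_zsmul`), so the eigen condition gives `(N − N') f' c₂ = 0` with
  `N − N' ≡ 2r − 1` a unit, whence `f' c₂ = 0` and `x = f c₁`; `c₁` is locally zero at `w ∤ p` (classical = locally trivial there,
  `localKerOver_top_eq_awayKer`, and `e_*` commutes with restriction), at `∞` (complex places), strict at `v` by (Hv), and in `L_M` by (Hv̄).
* §4 **`natCard_range_shaBridge_trueSelmer_eq`** — with part 1's injection: `#f(S_M) = #C`; hence, by -w7 g2's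
  `natCard_trueSelmer_quotient_eq_natCard_range_shaMap`, **`#((𝔖_v ⊓ L_M) ⧸ Q_M) = #C`** — and `#C = #Ш(W/ℚ)[2^∞]` on the crux's frames
  (`natCard_cmPrimary_sha_eq_of_isogeny`, p665921): factor (F2) of `rBV_of_three_factor_values` modulo (Hv), (Hv̄).

References: A. Agboola, Compositio 143 (2007) §6 Props. 6.10–6.11 [Agboola2007]; R. Greenberg, LNM 1716 (1999) §2 (p. 63, Prop. 2.1–2.2)
[GreenbergLNM1716]; K. Rubin, LNM 1716 (1999) §2 [Rubin1999]; J.-P. Serre, *Galois Cohomology* I.§2 [SerreGaloisCohomology1997].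
-/

noncomputable section

open scoped Classical

set_option linter.dupNamespace false
set_option autoImplicit false

namespace Summit.BirchSwinnertonDyer.BirchSwinnertonDyer.Theorems.PrintCf2.CMPrimes

open Literature.NumberTheory.EllipticCurves Literature.NumberTheory.GaloisRepresentations Field NumberField IsDedekindDomain
open Literature.NumberTheory.EllipticCurves.ResKernel Literature.NumberTheory.EllipticCurves.GreenbergSelmer
open Literature.NumberTheory.EllipticCurves.Agboola2007
open Summit.BirchSwinnertonDyer.BirchSwinnertonDyer.Theorems.PrintCf2.RestrictedSelmerPair

universe u

/-! ## §1 The equivariant projector onto a complemented stable subgroup and its shadow on `H¹` -/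

section Projector

variable {G : Type u} [Group G] [TopologicalSpace G] [IsTopologicalGroup G]
variable {A : Type u} [AddCommGroup A] [DistribMulAction G A] [TopologicalSpace A] [DiscreteTopology A]

omit [TopologicalSpace G] [IsTopologicalGroup G] [TopologicalSpace A] [DiscreteTopology A] in
/-- **Equivariant projector.** For `G`-stable subgroups `M`, `M'` of a `G`-module `A` with `M ⊓ M' = ⊥`, `M ⊔ M' = ⊤` there are additive
`e : A → M`, `e' : A → M'` with `e y + e' y = y`, `e|_M = id`, `e|_{M'} = 0` (and symmetrically), both `G`-equivariant (uniqueness of the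
decomposition; Mathlib's `Submodule.projection`; equivariance read in `A`). [folklore] -/
theorem exists_projector (M M' : AddSubgroup A) (hinf : M ⊓ M' = ⊥) (hsup : M ⊔ M' = ⊤)
    (hM : ∀ (g : G) (y : A), y ∈ M → g • y ∈ M) (hM' : ∀ (g : G) (y : A), y ∈ M' → g • y ∈ M') :
    ∃ (e : A →+ ↥M) (e' : A →+ ↥M'),
      (∀ y : A, ((e y : M) : A) + ((e' y : M') : A) = y) ∧ (∀ y : A, y ∈ M → ((e y : M) : A) = y) ∧
      (∀ y : A, y ∈ M' → e y = 0) ∧ (∀ y : A, y ∈ M → e' y = 0) ∧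
      (∀ (g : G) (y : A), ((e (g • y) : M) : A) = g • ((e y : M) : A)) ∧
      (∀ (g : G) (y : A), ((e' (g • y) : M') : A) = g • ((e' y : M') : A)) := by
  set P : Submodule ℤ A := AddSubgroup.toIntSubmodule M with hP
  set Q : Submodule ℤ A := AddSubgroup.toIntSubmodule M' with hQ
  have hc : IsCompl P Q :=
    (AddSubgroup.toIntSubmodule (M := A)).isCompl (isCompl_iff.mpr ⟨disjoint_iff.mpr hinf, codisjoint_iff.mpr hsup⟩)
  have hmemP : ∀ y : A, y ∈ P ↔ y ∈ M := fun _ ↦ Iff.rfl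
  have hmemQ : ∀ y : A, y ∈ Q ↔ y ∈ M' := fun _ ↦ Iff.rfl
  let e : A →+ ↥M :=
    { toFun := fun y ↦ ⟨P.projection Q hc y, (hmemP _).mp (Submodule.projection_apply_mem hc y)⟩
      map_zero' := Subtype.ext (by simp)
      map_add' := fun y z ↦ Subtype.ext (by simp) }
  let e' : A →+ ↥M' :=
    { toFun := fun y ↦ ⟨Q.projection P hc.symm y, (hmemQ _).mp (Submodule.projection_apply_mem hc.symm y)⟩
      map_zero' := Subtype.ext (by simp)
      map_add' := fun y z ↦ Subtype.ext (by simp) }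
  have he : ∀ y, ((e y : M) : A) = P.projection Q hc y := fun _ ↦ rfl
  have he' : ∀ y, ((e' y : M') : A) = Q.projection P hc.symm y := fun _ ↦ rfl
  have hsum : ∀ y : A, ((e y : M) : A) + ((e' y : M') : A) = y := fun y ↦ by
    rw [he, he']; exact Submodule.projection_add_projection_eq_self hc y
  have hleft : ∀ y : A, y ∈ M → ((e y : M) : A) = y := fun y hy ↦ by
    rw [he]; exact Submodule.projection_apply_of_mem_left hc ((hmemP y).mpr hy)
  have hright : ∀ y : A, y ∈ M' → e y = 0 := fun y hy ↦ Subtype.ext (by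
    rw [he, ZeroMemClass.coe_zero]; exact Submodule.projection_apply_of_mem_right hc ((hmemQ y).mpr hy))
  have hleft' : ∀ y : A, y ∈ M → e' y = 0 := fun y hy ↦ Subtype.ext (by
    rw [he', ZeroMemClass.coe_zero]; exact Submodule.projection_apply_of_mem_right hc.symm ((hmemP y).mpr hy))
  have hright' : ∀ y : A, y ∈ M' → ((e' y : M') : A) = y := fun y hy ↦ by
    rw [he']; exact Submodule.projection_apply_of_mem_left hc.symm ((hmemQ y).mpr hy)
  refine ⟨e, e', hsum, hleft, hright, hleft', fun g y ↦ ?_, fun g y ↦ ?_⟩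
  · -- `e (g y) = g (e y)`: decompose `y = e y + e' y` and use stability
    have h1 : ((e (g • ((e y : M) : A)) : M) : A) = g • ((e y : M) : A) := hleft _ (hM g _ (e y).2)
    have h2 : e (g • ((e' y : M') : A)) = 0 := hright _ (hM' g _ (e' y).2)
    conv_lhs => rw [← hsum y]
    rw [smul_add, map_add, AddSubgroup.coe_add, h1, h2, ZeroMemClass.coe_zero, add_zero]
  · have h1 : ((e' (g • ((e' y : M') : A)) : M') : A) = g • ((e' y : M') : A) := hright' _ (hM' g _ (e' y).2)
    have h2 : e' (g • ((e y : M) : A)) = 0 := hleft' _ (hM g _ (e y).2)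
    conv_lhs => rw [← hsum y]
    rw [smul_add, map_add, AddSubgroup.coe_add, h1, h2, ZeroMemClass.coe_zero, zero_add]

variable (H : Subgroup G)
variable {B : Type u} [AddCommGroup B] [DistribMulAction G B] [TopologicalSpace B] [DiscreteTopology B]
variable {B' : Type u} [AddCommGroup B'] [DistribMulAction G B'] [TopologicalSpace B'] [DiscreteTopology B']

/-- **The shadow of a pair of complementary equivariant projectors on `H¹(H, ·)`**: if `ι ∘ e + ι' ∘ e' = id_A` for equivariant
`ι : B → A`, `ι' : B' → A`, `e : A → B`, `e' : A → B'`, then `η = ι_*(e_* η) + ι'_*(e'_* η)` for every `η ∈ H¹(H, A)` (valuewise on a cocycle).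
[cite: SerreGaloisCohomology1997, I.§2.2] -/
theorem resH1Hom_projector_decomp (ι : B →+ A) (ι' : B' →+ A) (e : A →+ B) (e' : A →+ B')
    (hι : ∀ (g : ↥H) (b : B), ι (ContinuousMonoidHom.id _ g • b) = g • ι b)
    (hι' : ∀ (g : ↥H) (b : B'), ι' (ContinuousMonoidHom.id _ g • b) = g • ι' b)
    (he : ∀ (g : ↥H) (y : A), e (ContinuousMonoidHom.id _ g • y) = g • e y)
    (he' : ∀ (g : ↥H) (y : A), e' (ContinuousMonoidHom.id _ g • y) = g • e' y)
    (hsum : ∀ y : A, ι (e y) + ι' (e' y) = y) (η : subgroupH1 H A) :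
    η = resH1Hom (ContinuousMonoidHom.id _) ι hι (resH1Hom (ContinuousMonoidHom.id _) e he η) +
      resH1Hom (ContinuousMonoidHom.id _) ι' hι' (resH1Hom (ContinuousMonoidHom.id _) e' he' η) := by
  obtain ⟨a, rfl⟩ := oneCocycleClass_surjective (discreteTopRep (↥H) A) η
  rw [resH1Hom_id_oneCocycleClass, resH1Hom_id_oneCocycleClass, resH1Hom_id_oneCocycleClass, resH1Hom_id_oneCocycleClass,
    ← oneCocycleClass_add]
  congr 1
  apply Subtype.ext
  ext g
  rw [Submodule.coe_add, ContinuousMap.add_apply, contOneCocycles.push_apply, contOneCocycles.push_apply,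
    contOneCocycles.push_apply, contOneCocycles.push_apply, hsum]

/-- **Equivariant maps commute with restriction to a subgroup**: `res_{H' ≤ H} ∘ ψ_* = ψ_* ∘ res_{H' ≤ H}` (both are the map of the compatible
pair `(H' ↪ H, ψ)`). [cite: SerreGaloisCohomology1997, I.§2.4] -/
theorem resOfLe_resH1Hom_id_comm {H' : Subgroup G} (h : H' ≤ H) (ψ : A →+ B)
    (hψ : ∀ (g : ↥H) (y : A), ψ (ContinuousMonoidHom.id _ g • y) = g • ψ y)
    (hψ' : ∀ (g : ↥H') (y : A), ψ (ContinuousMonoidHom.id _ g • y) = g • ψ y) (η : subgroupH1 H A) :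
    Literature.NumberTheory.EllipticCurves.resOfLe B h (resH1Hom (ContinuousMonoidHom.id _) ψ hψ η) =
      resH1Hom (ContinuousMonoidHom.id _) ψ hψ' (Literature.NumberTheory.EllipticCurves.resOfLe A h η) := by
  have key : (Literature.NumberTheory.EllipticCurves.resOfLe B h).comp (resH1Hom (ContinuousMonoidHom.id _) ψ hψ) =
      (resH1Hom (ContinuousMonoidHom.id _) ψ hψ').comp (Literature.NumberTheory.EllipticCurves.resOfLe A h) := by
    rw [Literature.NumberTheory.EllipticCurves.resOfLe, Literature.NumberTheory.EllipticCurves.resOfLe, resH1Hom_comp,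
      resH1Hom_comp]
    exact resH1Hom_congr (ContinuousMonoidHom.ext fun _ ↦ rfl) (AddMonoidHom.ext fun _ ↦ rfl) _ _
  exact congrArg (fun F : subgroupH1 H A →+ subgroupH1 H' B ↦ F η) key

/-- `ι_* : H¹(H, B) → H¹(H, A)` is INJECTIVE when `ι` has an equivariant retraction `e` (`e ∘ ι = id`).
[cite: SerreGaloisCohomology1997, I.§2.2] -/
theorem resH1Hom_injective_of_retraction (ι : B →+ A) (e : A →+ B)
    (hι : ∀ (g : ↥H) (b : B), ι (ContinuousMonoidHom.id _ g • b) = g • ι b)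
    (he : ∀ (g : ↥H) (y : A), e (ContinuousMonoidHom.id _ g • y) = g • e y) (hret : ∀ b : B, e (ι b) = b) :
    Function.Injective (resH1Hom (ContinuousMonoidHom.id (↥H)) ι hι) := by
  have key : (resH1Hom (ContinuousMonoidHom.id _) e he).comp (resH1Hom (ContinuousMonoidHom.id (↥H)) ι hι) = AddMonoidHom.id _ := by
    rw [resH1Hom_comp, ← resH1Hom_id]
    exact resH1Hom_congr (ContinuousMonoidHom.ext fun _ ↦ rfl) (AddMonoidHom.ext fun b ↦ hret b) _ _
  intro c c' h
  have := congrArg (resH1Hom (ContinuousMonoidHom.id _) e he) h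
  rwa [← AddMonoidHom.comp_apply, ← AddMonoidHom.comp_apply, key] at this

end Projector

/-! ## §2 A unit congruence kills a `p^k`-torsion element -/

section Unit

/-- If `p^k • y = 0`, `A • y = 0` and the integer `A` is congruent modulo `p^k` to a UNIT `u` of `ℤ_p`, then `y = 0` (Bezout: `A` is
invertible modulo `p^k`). [folklore] -/
theorem eq_zero_of_zsmul_eq_zero_of_unit_approx (p : ℕ) [Fact p.Prime] {B : Type*} [AddCommGroup B] {k : ℕ} {y : B}
    (hk : p ^ k • y = 0) {A : ℤ} (hA : A • y = 0) {u : ℤ_[p]} (hu : IsUnit u)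
    (hAu : ((A : ℤ_[p]) - u) ∈ (Ideal.span {(p : ℤ_[p]) ^ k} : Ideal ℤ_[p])) : y = 0 := by
  obtain ⟨w, hw⟩ := hu.exists_right_inv
  obtain ⟨Bz, hB⟩ := exists_int_sub_mem_span_pow p w k
  -- `A * Bz ≡ 1 (mod p^k)`
  have h1 : (((A * Bz - 1 : ℤ) : ℤ_[p])) ∈ (Ideal.span {(p : ℤ_[p]) ^ k} : Ideal ℤ_[p]) := by
    have e : ((A * Bz - 1 : ℤ) : ℤ_[p]) = ((A : ℤ_[p]) - u) * (Bz : ℤ_[p]) + u * ((Bz : ℤ_[p]) - w) := by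
      push_cast; linear_combination hw
    rw [e]
    exact Ideal.add_mem _ (Ideal.mul_mem_right _ _ hAu) (Ideal.mul_mem_left _ _ hB)
  have hdvd : (p ^ k : ℤ) ∣ A * Bz - 1 := by
    rw [← PadicInt.norm_int_le_pow_iff_dvd]
    exact (PadicInt.norm_le_pow_iff_mem_span_pow _ _).mpr h1
  obtain ⟨t, ht⟩ := hdvd
  have hpk : ((p : ℤ) ^ k) • y = 0 := by
    rw [show ((p : ℤ) ^ k) = ((p ^ k : ℕ) : ℤ) by push_cast; rfl, natCast_zsmul, hk]
  calc y = (1 : ℤ) • y := (one_zsmul y).symm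
    _ = (A * Bz - (p : ℤ) ^ k * t) • y := by rw [← ht]; ring_nf
    _ = 0 := by rw [sub_zsmul, mul_comm A, mul_zsmul, hA, zsmul_zero, mul_comm, mul_zsmul, hpk, zsmul_zero]; simp

end Unit

/-! ## §3 Every `r`-eigen class of `Ш[p^∞]` is the bridge image of a class of the true Selmer group of `E[𝔮^∞]` -/

section Surj

variable {K : Type u} [Field K] [NumberField K] (V : WeierstrassCurve K) [V.IsElliptic] (p : ℕ) [Fact p.Prime]
  (π : V.endRing) (r : ℤ_[p]) (v vbar : HeightOneSpectrum (𝓞 K))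

set_option maxHeartbeats 400000 in
/-- **EVERY `r`-EIGEN CLASS IS A BRIDGE IMAGE FROM THE TRUE SELMER GROUP OF `E[𝔮^∞]`.** `V/K` elliptic, `K` imaginary quadratic, `p` prime,
`π ∈ End_K(E)`, `r ∈ ℤ_p` with `2r − 1 ∈ ℤ_pˣ`, the eigen-summands `M = E[𝔮^∞]` (`r`) and `M̄` (`1 − r`) complementary in `E[p^∞]`, `φ` an isogeny
acting as `π`; GRANTED (Hv): the `M`-component of a class of `H¹(⊤, E[p^∞])` classical at `v` restricts to `0` on `⊤ ⊓ D_v`, and (Hv̄): the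
`M`-component of a class classical at `v̄` is classical at `v̄`. Then every `x` in the `r`-eigen subgroup `C` of `Ш(E_K/K)[p^∞]` is `f c` for some
`c ∈ 𝔖_v(K, M) ⊓ L_M`. [cite: Agboola2007, Props. 6.10–6.11 (arXiv p0014:L1–p0015:L12)] [cite: GreenbergLNM1716, §2 p. 63 and Prop. 2.1] -/
theorem exists_mem_trueSelmer_shaBridge_eq (hK : IsImaginaryQuadratic K) (hu : IsUnit (2 * r - 1))
    (hinf : V.endEigenPrimaryTorsion p π r ⊓ V.endEigenPrimaryTorsion p π (1 - r) = ⊥)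
    (hsup : V.endEigenPrimaryTorsion p π r ⊔ V.endEigenPrimaryTorsion p π (1 - r) = ⊤)
    (φ : WeierstrassCurve.Isogeny V V) (hφ : ∀ P, φ P = (π : AddMonoid.End V.geomPoints) P)
    (Hv : ∀ (η : subgroupH1 (⊤ : Subgroup (absoluteGaloisGroup K)) ↥(V.geomPrimaryTorsion p))
      (c : subgroupH1 (⊤ : Subgroup (absoluteGaloisGroup K)) ↥(V.endEigenPrimaryTorsion p π r))
      (c' : subgroupH1 (⊤ : Subgroup (absoluteGaloisGroup K)) ↥(V.endEigenPrimaryTorsion p π (1 - r))),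
      η ∈ V.localKerOver p ⊤ (v.adicCompletion K) →
      η = resH1Hom (ContinuousMonoidHom.id _) (V.endEigenPrimaryTorsion p π r).subtype (fun _ _ ↦ rfl) c +
        resH1Hom (ContinuousMonoidHom.id _) (V.endEigenPrimaryTorsion p π (1 - r)).subtype (fun _ _ ↦ rfl) c' →
      Literature.NumberTheory.EllipticCurves.resOfLe ↥(V.endEigenPrimaryTorsion p π r) (inf_le_left : ⊤ ⊓ decomp v ≤ ⊤) c = 0)
    (Hvbar : ∀ (η : subgroupH1 (⊤ : Subgroup (absoluteGaloisGroup K)) ↥(V.geomPrimaryTorsion p))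
      (c : subgroupH1 (⊤ : Subgroup (absoluteGaloisGroup K)) ↥(V.endEigenPrimaryTorsion p π r))
      (c' : subgroupH1 (⊤ : Subgroup (absoluteGaloisGroup K)) ↥(V.endEigenPrimaryTorsion p π (1 - r))),
      η ∈ V.localKerOver p ⊤ (vbar.adicCompletion K) →
      η = resH1Hom (ContinuousMonoidHom.id _) (V.endEigenPrimaryTorsion p π r).subtype (fun _ _ ↦ rfl) c +
        resH1Hom (ContinuousMonoidHom.id _) (V.endEigenPrimaryTorsion p π (1 - r)).subtype (fun _ _ ↦ rfl) c' →
      resH1Hom (ContinuousMonoidHom.id _) (V.endEigenPrimaryTorsion p π r).subtype (fun _ _ ↦ rfl) c ∈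
        V.localKerOver p ⊤ (vbar.adicCompletion K))
    {C : AddSubgroup (AddCommGroup.primaryComponent V.sha p)}
    (hC : ∀ x, x ∈ C ↔ ∀ (k : ℕ) (N : ℤ), p ^ k • x = 0 →
      ((N : ℤ_[p]) - r) ∈ (Ideal.span {(p : ℤ_[p]) ^ k} : Ideal ℤ_[p]) →
        galH1Map φ.toAddMonoidHom φ.equivariant (((x : AddCommGroup.primaryComponent V.sha p) : V.sha) : V.galH1) =
          N • (((x : AddCommGroup.primaryComponent V.sha p) : V.sha) : V.galH1))
    (x : AddCommGroup.primaryComponent V.sha p) (hx : x ∈ C) :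
    ∃ c ∈ restrictedSelmerBase ↥(V.endEigenPrimaryTorsion p π r) p v ⊓
        (V.localKerOver p ⊤ (vbar.adicCompletion K)).comap
          (resH1Hom (ContinuousMonoidHom.id _) (V.endEigenPrimaryTorsion p π r).subtype (fun _ _ ↦ rfl)),
      V.primaryH1ToH1 p ((AddEquiv.ofBijective (resSubgroup (⊤ : Subgroup (absoluteGaloisGroup K)) ↥(V.geomPrimaryTorsion p))
        (resSubgroup_top_bijective ↥(V.geomPrimaryTorsion p))).symm
          (resH1Hom (ContinuousMonoidHom.id _) (V.endEigenPrimaryTorsion p π r).subtype (fun _ _ ↦ rfl) c)) =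
        ((x : V.sha) : V.galH1) := by
  -- notation
  set M := V.endEigenPrimaryTorsion p π r with hM
  set M' := V.endEigenPrimaryTorsion p π (1 - r) with hM'
  set Re := AddEquiv.ofBijective (resSubgroup (⊤ : Subgroup (absoluteGaloisGroup K)) ↥(V.geomPrimaryTorsion p))
    (resSubgroup_top_bijective ↥(V.geomPrimaryTorsion p)) with hRe
  set ιM := resH1Hom (ContinuousMonoidHom.id (↥(⊤ : Subgroup (absoluteGaloisGroup K)))) M.subtype (fun _ _ ↦ rfl) with hιM
  set ιM' := resH1Hom (ContinuousMonoidHom.id (↥(⊤ : Subgroup (absoluteGaloisGroup K)))) M'.subtype (fun _ _ ↦ rfl) with hιM'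
  -- §1: the projector and its shadow
  obtain ⟨e, e', hsum, hleft, hright, hleft', heG, he'G⟩ := exists_projector (G := absoluteGaloisGroup K) M M' hinf hsup
    (fun g y hy ↦ V.smul_mem_endEigenPrimaryTorsion π r g hy) (fun g y hy ↦ V.smul_mem_endEigenPrimaryTorsion π (1 - r) g hy)
  have heΓ : ∀ (g : absoluteGaloisGroup K) (y : V.geomPrimaryTorsion p), e (g • y) = g • e y := fun g y ↦
    Subtype.ext (by rw [WeierstrassCurve.endEigenPrimaryTorsion.coe_smul]; exact heG g y)
  have he'Γ : ∀ (g : absoluteGaloisGroup K) (y : V.geomPrimaryTorsion p), e' (g • y) = g • e' y := fun g y ↦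
    Subtype.ext (by rw [WeierstrassCurve.endEigenPrimaryTorsion.coe_smul]; exact he'G g y)
  have he : ∀ (g : ↥(⊤ : Subgroup (absoluteGaloisGroup K))) (y : V.geomPrimaryTorsion p),
      e (ContinuousMonoidHom.id _ g • y) = g • e y := fun g y ↦ heΓ g y
  have he' : ∀ (g : ↥(⊤ : Subgroup (absoluteGaloisGroup K))) (y : V.geomPrimaryTorsion p),
      e' (ContinuousMonoidHom.id _ g • y) = g • e' y := fun g y ↦ he'Γ g y
  have hsum' : ∀ y : V.geomPrimaryTorsion p, M.subtype (e y) + M'.subtype (e' y) = y := fun y ↦ hsum y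
  -- the class `x`, its Selmer lift `ξ`, and the decomposition of `η = res_⊤ ξ`
  have hxprim : ((x : V.sha) : V.galH1) ∈ AddCommGroup.primaryComponent V.galH1 p := by
    obtain ⟨n, hn⟩ := (AddCommGroup.mem_primaryComponent).mp x.2
    refine (AddCommGroup.mem_primaryComponent).mpr ⟨n, ?_⟩
    have h := congrArg (fun z : V.sha ↦ (z : V.galH1)) hn
    simpa using h
  obtain ⟨ξ, hξ⟩ := WeierstrassCurve.primaryComponent_le_range_primaryH1ToH1 V p V.zsmul_geomPoints_surjective_holds hxprim
  have hξsel : ξ ∈ V.selmerGroupPInfty p := by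
    rw [V.selmerGroupPInfty_eq_comap_sha p, AddSubgroup.mem_comap, hξ]
    exact (x : V.sha).2
  set η := resSubgroup (⊤ : Subgroup (absoluteGaloisGroup K)) ↥(V.geomPrimaryTorsion p) ξ with hη
  set c₁ := resH1Hom (ContinuousMonoidHom.id _) e he η with hc₁
  set c₂ := resH1Hom (ContinuousMonoidHom.id _) e' he' η with hc₂
  have hdec : η = ιM c₁ + ιM' c₂ :=
    resH1Hom_projector_decomp ⊤ M.subtype M'.subtype e e' (fun _ _ ↦ rfl) (fun _ _ ↦ rfl) he he' hsum' η
  have hReξ : Re ξ = η := rfl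
  -- local conditions of `η` from `ξ ∈ Sel`
  have hηloc : ∀ w : HeightOneSpectrum (𝓞 K), η ∈ V.localKerOver p ⊤ (w.adicCompletion K) := fun w ↦ by
    have h1 : ξ ∈ V.selmerLocalKerPrimary (w.adicCompletion K) p := by
      have h := hξsel
      simp only [WeierstrassCurve.selmerGroupPInfty, AddSubgroup.mem_inf, AddSubgroup.mem_iInf] at h
      exact h.1 w
    rw [selmerLocalKerPrimary_eq_comap_localKerOver, AddSubgroup.mem_comap] at h1
    exact h1
  -- the two bridge images
  set y₁ := V.primaryH1ToH1 p (Re.symm (ιM c₁)) with hy₁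
  set y₂ := V.primaryH1ToH1 p (Re.symm (ιM' c₂)) with hy₂
  have hxy : ((x : V.sha) : V.galH1) = y₁ + y₂ := by
    rw [← hξ, hy₁, hy₂, ← map_add, ← map_add, ← hdec, ← hReξ, AddEquiv.symm_apply_apply]
  -- exponents
  obtain ⟨k₀, hk₀⟩ := (AddCommGroup.mem_primaryComponent).mp x.2
  obtain ⟨k₁, hk₁⟩ := (AddCommGroup.mem_primaryComponent).mp (shaBridge_mem_primaryComponent V p (Re.symm (ιM c₁)))
  obtain ⟨k₂, hk₂⟩ := (AddCommGroup.mem_primaryComponent).mp (shaBridge_mem_primaryComponent V p (Re.symm (ιM' c₂)))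
  set k := k₀ + k₁ + k₂ with hk
  have hpow : ∀ {B : Type u} [AddCommGroup B] {z : B} {i : ℕ}, p ^ i • z = 0 → i ≤ k → p ^ k • z = 0 := by
    intro B _ z i hz hik
    obtain ⟨d, hd⟩ := Nat.exists_eq_add_of_le hik
    rw [hd, pow_add, mul_comm, mul_smul, hz, smul_zero]
  have hkx : p ^ k • x = 0 :=
    Subtype.ext (by rw [AddSubmonoidClass.coe_nsmul, ZeroMemClass.coe_zero]; exact hpow hk₀ (by rw [hk]; omega))
  have hky₁ : p ^ k • y₁ = 0 := hpow hk₁ (by rw [hk]; omega)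
  have hky₂ : p ^ k • y₂ = 0 := hpow hk₂ (by rw [hk]; omega)
  obtain ⟨N, hN⟩ := exists_int_sub_mem_span_pow p r k
  have hN' : (((1 - N : ℤ) : ℤ_[p]) - (1 - r)) ∈ (Ideal.span {(p : ℤ_[p]) ^ k} : Ideal ℤ_[p]) := by
    have : (((1 - N : ℤ) : ℤ_[p]) - (1 - r)) = -(((N : ℤ_[p]) - r)) := by push_cast; ring
    rw [this]; exact neg_mem hN
  -- the eigen actions
  have hφ₁ : galH1Map φ.toAddMonoidHom φ.equivariant y₁ = N • y₁ := galH1Map_shaBridge_eq_zsmul V p π r φ hφ c₁ hky₁ hN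
  have hφ₂ : galH1Map φ.toAddMonoidHom φ.equivariant y₂ = (1 - N : ℤ) • y₂ :=
    galH1Map_shaBridge_eq_zsmul V p π (1 - r) φ hφ c₂ hky₂ hN'
  have hφx : galH1Map φ.toAddMonoidHom φ.equivariant ((x : V.sha) : V.galH1) = N • ((x : V.sha) : V.galH1) := (hC x).mp hx k N hkx hN
  -- `(N − (1 − N)) • y₂ = 0`, `N − (1 − N) ≡ 2r − 1` a unit ⟹ `y₂ = 0`
  have hy₂zero : y₂ = 0 := by
    have h1 : N • y₁ + (1 - N : ℤ) • y₂ = N • y₁ + N • y₂ :=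
      calc N • y₁ + (1 - N : ℤ) • y₂
          = galH1Map φ.toAddMonoidHom φ.equivariant y₁ + galH1Map φ.toAddMonoidHom φ.equivariant y₂ := by rw [hφ₁, hφ₂]
        _ = galH1Map φ.toAddMonoidHom φ.equivariant ((x : V.sha) : V.galH1) := by rw [hxy, map_add]
        _ = N • y₁ + N • y₂ := by rw [hφx, hxy, zsmul_add]
    have h3 : (1 - N : ℤ) • y₂ = N • y₂ := add_left_cancel h1
    have h2 : (N - (1 - N) : ℤ) • y₂ = 0 := by
      rw [sub_zsmul, h3]; simp
    refine eq_zero_of_zsmul_eq_zero_of_unit_approx p hky₂ h2 hu ?_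
    have : (((N - (1 - N) : ℤ) : ℤ_[p]) - (2 * r - 1)) = 2 * (((N : ℤ_[p]) - r)) := by push_cast; ring
    rw [this]; exact Ideal.mul_mem_left _ _ hN
  -- local conditions of `c₁`
  have hfin : ∀ w : HeightOneSpectrum (𝓞 K), ((p : ℕ) : 𝓞 K) ∉ w.asIdeal → Literature.NumberTheory.EllipticCurves.resOfLe ↥M (inf_le_left : ⊤ ⊓ decomp w ≤ ⊤) c₁ = 0 := by
    intro w hw
    have hηw : Literature.NumberTheory.EllipticCurves.resOfLe ↥(V.geomPrimaryTorsion p) (inf_le_left : ⊤ ⊓ decomp w ≤ ⊤) η = 0 := by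
      have h := hηloc w
      rw [localKerOver_top_eq_awayKer V p w hw] at h
      exact h
    rw [hc₁, resOfLe_resH1Hom_id_comm ⊤ (inf_le_left : ⊤ ⊓ decomp w ≤ ⊤) e he (fun g y ↦ heΓ g y), hηw, map_zero]
  have hstrict : Literature.NumberTheory.EllipticCurves.resOfLe ↥M (inf_le_left : ⊤ ⊓ decomp v ≤ ⊤) c₁ = 0 := Hv η c₁ c₂ (hηloc v) hdec
  have hmem𝔖 : c₁ ∈ restrictedSelmerBase ↥M p v :=
    (mem_restrictedSelmerBase_iff_resOfLe ↥M p v c₁).mpr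
      ⟨hfin, fun w ↦ resOfLe_decompInf_eq_zero_of_isImaginaryQuadratic ↥M hK w c₁, hstrict⟩
  have hmemL : c₁ ∈ (V.localKerOver p ⊤ (vbar.adicCompletion K)).comap ιM :=
    AddSubgroup.mem_comap.mpr (Hvbar η c₁ c₂ (hηloc vbar) hdec)
  refine ⟨c₁, AddSubgroup.mem_inf.mpr ⟨hmem𝔖, hmemL⟩, ?_⟩
  rw [hxy, hy₂zero, add_zero]

/-! ## §4 The bijection `f(𝔖_v ⊓ L_M) ≃ C` and the middle factor of the bottom value -/

/-- **`#f(𝔖_v(K, E[𝔮^∞]) ⊓ L_M) = #C`** — the bridge image of the true Selmer group of the `𝔮`-summand and THE `r`-eigen subgroup of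
`Ш(E_K/K)[p^∞]` are in bijection (injection: part 1, `exists_injective_range_shaBridge_to_eigen`; surjection:
`exists_mem_trueSelmer_shaBridge_eq`), under (Hv), (Hv̄), complementarity and `2r − 1 ∈ ℤ_pˣ`. `Nat.card`, no finiteness.
[cite: Agboola2007, Props. 6.10–6.11 (arXiv p0014:L1–p0015:L12)] -/
theorem natCard_range_shaBridge_trueSelmer_eq (hK : IsImaginaryQuadratic K)
    (hall : ∀ w : HeightOneSpectrum (𝓞 K), ((p : ℕ) : 𝓞 K) ∈ w.asIdeal → w = v ∨ w = vbar) (hu : IsUnit (2 * r - 1))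
    (hinf : V.endEigenPrimaryTorsion p π r ⊓ V.endEigenPrimaryTorsion p π (1 - r) = ⊥)
    (hsup : V.endEigenPrimaryTorsion p π r ⊔ V.endEigenPrimaryTorsion p π (1 - r) = ⊤)
    (φ : WeierstrassCurve.Isogeny V V) (hφ : ∀ P, φ P = (π : AddMonoid.End V.geomPoints) P)
    (Hv : ∀ (η : subgroupH1 (⊤ : Subgroup (absoluteGaloisGroup K)) ↥(V.geomPrimaryTorsion p))
      (c : subgroupH1 (⊤ : Subgroup (absoluteGaloisGroup K)) ↥(V.endEigenPrimaryTorsion p π r))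
      (c' : subgroupH1 (⊤ : Subgroup (absoluteGaloisGroup K)) ↥(V.endEigenPrimaryTorsion p π (1 - r))),
      η ∈ V.localKerOver p ⊤ (v.adicCompletion K) →
      η = resH1Hom (ContinuousMonoidHom.id _) (V.endEigenPrimaryTorsion p π r).subtype (fun _ _ ↦ rfl) c +
        resH1Hom (ContinuousMonoidHom.id _) (V.endEigenPrimaryTorsion p π (1 - r)).subtype (fun _ _ ↦ rfl) c' →
      Literature.NumberTheory.EllipticCurves.resOfLe ↥(V.endEigenPrimaryTorsion p π r) (inf_le_left : ⊤ ⊓ decomp v ≤ ⊤) c = 0)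
    (Hvbar : ∀ (η : subgroupH1 (⊤ : Subgroup (absoluteGaloisGroup K)) ↥(V.geomPrimaryTorsion p))
      (c : subgroupH1 (⊤ : Subgroup (absoluteGaloisGroup K)) ↥(V.endEigenPrimaryTorsion p π r))
      (c' : subgroupH1 (⊤ : Subgroup (absoluteGaloisGroup K)) ↥(V.endEigenPrimaryTorsion p π (1 - r))),
      η ∈ V.localKerOver p ⊤ (vbar.adicCompletion K) →
      η = resH1Hom (ContinuousMonoidHom.id _) (V.endEigenPrimaryTorsion p π r).subtype (fun _ _ ↦ rfl) c +
        resH1Hom (ContinuousMonoidHom.id _) (V.endEigenPrimaryTorsion p π (1 - r)).subtype (fun _ _ ↦ rfl) c' →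
      resH1Hom (ContinuousMonoidHom.id _) (V.endEigenPrimaryTorsion p π r).subtype (fun _ _ ↦ rfl) c ∈
        V.localKerOver p ⊤ (vbar.adicCompletion K))
    {C : AddSubgroup (AddCommGroup.primaryComponent V.sha p)}
    (hC : ∀ x, x ∈ C ↔ ∀ (k : ℕ) (N : ℤ), p ^ k • x = 0 →
      ((N : ℤ_[p]) - r) ∈ (Ideal.span {(p : ℤ_[p]) ^ k} : Ideal ℤ_[p]) →
        galH1Map φ.toAddMonoidHom φ.equivariant (((x : AddCommGroup.primaryComponent V.sha p) : V.sha) : V.galH1) =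
          N • (((x : AddCommGroup.primaryComponent V.sha p) : V.sha) : V.galH1)) :
    Nat.card ↥(((V.primaryH1ToH1 p).comp (AddEquiv.ofBijective (resSubgroup (⊤ : Subgroup (absoluteGaloisGroup K)) ↥(V.geomPrimaryTorsion p))
        (resSubgroup_top_bijective ↥(V.geomPrimaryTorsion p))).symm.toAddMonoidHom).comp
      ((resH1Hom (ContinuousMonoidHom.id _) (V.endEigenPrimaryTorsion p π r).subtype (fun _ _ ↦ rfl)).comp
        (restrictedSelmerBase ↥(V.endEigenPrimaryTorsion p π r) p v ⊓
            (V.localKerOver p ⊤ (vbar.adicCompletion K)).comap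
              (resH1Hom (ContinuousMonoidHom.id _) (V.endEigenPrimaryTorsion p π r).subtype (fun _ _ ↦ rfl))).subtype)).range =
      Nat.card ↥C := by
  set S := restrictedSelmerBase ↥(V.endEigenPrimaryTorsion p π r) p v ⊓
    (V.localKerOver p ⊤ (vbar.adicCompletion K)).comap
      (resH1Hom (ContinuousMonoidHom.id _) (V.endEigenPrimaryTorsion p π r).subtype (fun _ _ ↦ rfl)) with hS
  have hSsha := (natCard_trueSelmer_quotient_eq_natCard_range_shaMap V p π r v vbar hK hall).2
  obtain ⟨ε, hεinj, hεval⟩ := exists_injective_range_shaBridge_to_eigen V p π r S φ hφ hSsha hC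
  refine Nat.card_congr (Equiv.ofBijective ε ⟨hεinj, fun z ↦ ?_⟩)
  obtain ⟨c, hc, hcz⟩ := exists_mem_trueSelmer_shaBridge_eq V p π r v vbar hK hu hinf hsup φ hφ Hv Hvbar hC z z.2
  refine ⟨⟨_, ⟨⟨c, hc⟩, rfl⟩⟩, ?_⟩
  apply Subtype.ext; apply Subtype.ext; apply Subtype.ext
  rw [hεval]
  exact hcz

end Surj

end Summit.BirchSwinnertonDyer.BirchSwinnertonDyer.Theorems.PrintCf2.CMPrimes

end
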